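import Summits.QuantumFields.YangMills.Theorems.LangevinControlUVFemtoCurvatureTwoPointCDefsCore
import Summits.QuantumFields.YangMills.Theorems.LangevinControlUVFemtoCurvatureTwoPointCoreAssembly
import Summits.QuantumFields.YangMills.Theorems.LangevinControlUVFemtoCurvatureTwoPointStubVarianceOfChessboardDoubling
import Literature.MathematicalPhysics.QuantumFieldTheory.WilsonEnergyConvexity

/-!
# Route `LangevinControlUV`, crux `FemtoCurvatureTwoPointC` (stmt-QuantumFields-16204), line `birth` —
# the bare plaquette variance on EVEN tori from an `L`-UNIFORM torus doubling

Registered wave-1 sub-goal `bareVarianceEven_of_uniformDoubling` (`--supports stmt-QuantumFields-16204`),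
proved verbatim. Setting: a compact group `G`, a lattice representation `r` (continuous unitary
`r.ρ : G →* M_N(ℂ)`), the torus `(ℤ/L)⁴` with `L` even and `L ≥ 8` (`k = L⁴` sites),
`P_x(U) = N − Re tr r.ρ(U_{x;01}) ∈ [0, 2N]` the `01`-plaquette field, `S = wilsonAction r.ρ ≥ ∑ₓ P_x`
Wilson's action, `Z_L(β)` the partition function and `⟨·⟩_β = wilsonExpectation r.ρ β`.

**Statement.** If ONE constant `A` gives the torus free-energy doubling
`Z_L(β/2) ≤ e^{A L⁴} Z_L(β)` for every even `L ≥ 8` and every `β ≥ β₁` (an `L`-UNIFORM threshold),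
then there is `C₃` with `Var_{L,β}(P_0^{01}) = ⟨P_0 P_0⟩_β − ⟨P_0⟩_β² ≤ C₃ / β²` for every even `L ≥ 8`
and every `β ≥ max(β₁, 1)`; in fact `C₃ = 16 e^{A} / e²`.

This is the uniform-threshold form of the landed `FemtoCurvatureTwoPoint.stub_varianceEven_of_chessboard_doubling`
(p115461, line `generic-step-gamma-encoding` of stmt-QuantumFields-9363), whose doubling hypothesis and
conclusion carry an `L`-DEPENDENT threshold `B(L)`; the crux `FemtoCurvatureTwoPointC` needs the window
boxes `L ≥ 8` with one threshold, so the doubling is taken here as a hypothesis with one `β₁` and the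
bookkeeping of thresholds disappears. The proof is otherwise the same:

* `Var P_0 ≤ |Var P_0| ≤ ⟨P_0²⟩_β` (variance of a bounded observable under Wilson's probability measure,
  `PlaquetteVariance.abs_var_le_wilsonExpectation_sq`);
* the chessboard estimate on even tori (reflection positivity in all four directions; LANDED
  `plaquetteChessboardEven_holds`, p114602 via `…TwoPointCoreAssembly`) with `f = min(t², 4N²)`,
  `f(P_x) = P_x²`: `⟨P_0²⟩_β ≤ ⟨∏ₓ P_x²⟩_β^{1/k}`;
* AM–GM and the moment bound `y² ≤ (4/(eβ))² e^{βy/2}` together with `∑ₓ P_x ≤ S`: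
  `⟨∏ₓ P_x²⟩_β ≤ (4/(eβ))^{2k} ⟨e^{βS/2}⟩_β = (4/(eβ))^{2k} Z_L(β/2)/Z_L(β) ≤ ((4/(eβ))² e^{A})^{k}`
  (`PlaquetteVariance.wilsonExpectation_prod_sq_le` and the doubling hypothesis);
* the `k`-th root: `⟨P_0²⟩_β ≤ 16 e^{A}/(e² β²)`.

All helper inequalities are the public lemmas of namespace `FemtoCurvatureTwoPoint.PlaquetteVariance`
(tree file `…TwoPointStubVarianceOfChessboardDoubling`); nothing is duplicated here. Mathlib + tree only.
-/

set_option autoImplicit false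

noncomputable section

open Filter Topology MeasureTheory
open Literature.MathematicalPhysics.QuantumFieldTheory
open Summit.QuantumFields.YangMills.Theorems.FemtoCurvatureTwoPoint.PlaquetteVariance
open Summit.QuantumFields.YangMills.Cruxes.FemtoCurvatureTwoPoint.GenericStepGammaEncoding
  (PlaquetteChessboardEven plaquetteChessboardEven_holds)

namespace Summit.QuantumFields.YangMills.Theorems.FemtoCurvatureTwoPointC

/-- **The bare plaquette variance on even tori from an `L`-uniform torus doubling** (registered wave-1
sub-goal of line `birth`, crux `FemtoCurvatureTwoPointC`, stmt-QuantumFields-16204; the signature verbatim).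
If `Z_L(β/2) ≤ e^{A L⁴} Z_L(β)` for every even `L ≥ 8` and every `β ≥ β₁`, then
`⟨P_0 P_0⟩_β − ⟨P_0⟩_β² ≤ C₃ · (β²)⁻¹` for every even `L ≥ 8` and `β ≥ max(β₁, 1)`, with
`C₃ = 16 e^{A} / e²`, `P_0 = N − Re tr r.ρ(U_{0;01})` (chessboard estimate p114602 + AM–GM + doubling;
uniform-threshold form of p115461). [folklore] -/
theorem bareVarianceEven_of_uniformDoubling :
    ∀ {G : Type} [Group G] [TopologicalSpace G] [IsTopologicalGroup G] [CompactSpace G]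
        [MeasurableSpace G] [BorelSpace G] (r : LatticeRep G) (A β₁ : ℝ),
      (∀ (L : ℕ) [NeZero L], Even L → 8 ≤ L → ∀ β : ℝ, β₁ ≤ β →
          (partitionFunction (d := 4) (L := L) r.ρ (β / 2)).toReal ≤
            Real.exp (A * (L : ℝ) ^ 4) * (partitionFunction (d := 4) (L := L) r.ρ β).toReal) →
      ∃ C₃ : ℝ, ∀ (L : ℕ) [NeZero L], Even L → 8 ≤ L → ∀ β : ℝ, max β₁ 1 ≤ β →
          ∀ (P : (Fin 4 → ZMod L) → Fin 4 → Fin 4 → GaugeConfig 4 L G → ℝ)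
            (E : (GaugeConfig 4 L G → ℝ) → ℝ),
            (P = fun x i j U => (r.N : ℝ) - (r.ρ (plaquetteHolonomy U x i j)).trace.re) →
            (E = fun F => wilsonExpectation r.ρ β F) →
            E (fun U => P 0 0 1 U * P 0 0 1 U) - E (P 0 0 1) * E (P 0 0 1) ≤ C₃ * (β ^ 2)⁻¹ := by
  intro G i1 i2 i3 i4 i5 i6 r A β₁ hDbl
  refine ⟨16 * Real.exp A / Real.exp 1 ^ 2, ?_⟩
  intro L iL hL h8 β hβ P E hP hE
  subst hP hE
  dsimp only
  have hβ1 : 1 ≤ β := le_trans (le_max_right _ _) hβ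
  have hβ0 : 0 < β := lt_of_lt_of_le one_pos hβ1
  -- the doubling at `(L, β)`: `β₁ ≤ max β₁ 1 ≤ β`
  have hdbl : (partitionFunction (d := 4) (L := L) r.ρ (β / 2)).toReal ≤
      Real.exp (A * (L : ℝ) ^ 4) * (partitionFunction (d := 4) (L := L) r.ρ β).toReal :=
    hDbl L hL h8 β (le_trans (le_max_left _ _) hβ)
  -- (i) `|Var P| ≤ ⟨P²⟩`
  have hXm := measurable_plaq01 r.ρ r.continuous (0 : Site 4 L)
  have hXb : ∀ U : GaugeConfig 4 L G,
      |(r.N : ℝ) - (r.ρ (plaquetteHolonomy U 0 0 1)).trace.re| ≤ 2 * r.N := fun U => by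
    obtain ⟨h0, h2⟩ := plaqField_mem r.ρ r.continuous (plaquetteHolonomy U 0 0 1)
    rw [abs_of_nonneg h0]
    exact h2
  have hvar := abs_var_le_wilsonExpectation_sq r.ρ r.continuous β hXm hXb
  -- (ii) chessboard (landed, all even tori) with `f = min (t², 4N²)`, `f(P_x) = P_x²`
  have hCh : PlaquetteChessboardEven := plaquetteChessboardEven_holds
  unfold PlaquetteChessboardEven at hCh
  have hmin : ∀ (U : GaugeConfig 4 L G) (x : Site 4 L),
      min (((r.N : ℝ) - (r.ρ (plaquetteHolonomy U x 0 1)).trace.re) ^ 2) ((2 * (r.N : ℝ)) ^ 2) =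
        ((r.N : ℝ) - (r.ρ (plaquetteHolonomy U x 0 1)).trace.re) ^ 2 := fun U x => by
    obtain ⟨h0, h2⟩ := plaqField_mem r.ρ r.continuous (plaquetteHolonomy U x 0 1)
    exact min_eq_left (pow_le_pow_left₀ h0 h2 2)
  have hf := hCh G r.N r.ρ r.continuous r.mem_unitary L hL β hβ0.le
    (fun t => min (t ^ 2) ((2 * (r.N : ℝ)) ^ 2))
    ((continuous_id.pow 2).min continuous_const).measurable
    (fun t => le_min (sq_nonneg t) (sq_nonneg _)) ⟨(2 * (r.N : ℝ)) ^ 2, fun t => min_le_right _ _⟩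
  simp only [hmin] at hf
  -- (iii)–(v) `⟨∏ₓ P_x²⟩ ≤ M^{L⁴}` with `M = (4/(eβ))² e^{A}`
  have hprod : wilsonExpectation r.ρ β (fun U : GaugeConfig 4 L G =>
      ∏ x : Site 4 L, ((r.N : ℝ) - (r.ρ (plaquetteHolonomy U x 0 1)).trace.re) ^ 2) ≤
        ((4 / (Real.exp 1 * β)) ^ 2 * Real.exp A) ^ (L ^ 4) := by
    refine (wilsonExpectation_prod_sq_le r.ρ r.continuous hβ0).trans ?_
    have hZ := partitionFunction_toReal_pos (d := 4) (L := L) r.ρ r.continuous β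
    have hratio : (partitionFunction (d := 4) (L := L) r.ρ (β / 2)).toReal /
        (partitionFunction (d := 4) (L := L) r.ρ β).toReal ≤ Real.exp (A * (L : ℝ) ^ 4) := by
      rw [div_le_iff₀ hZ]
      exact hdbl
    calc (4 / (Real.exp 1 * β)) ^ (2 * L ^ 4) *
          ((partitionFunction (d := 4) (L := L) r.ρ (β / 2)).toReal /
            (partitionFunction (d := 4) (L := L) r.ρ β).toReal)
        ≤ (4 / (Real.exp 1 * β)) ^ (2 * L ^ 4) * Real.exp (A * (L : ℝ) ^ 4) :=
          mul_le_mul_of_nonneg_left hratio (pow_nonneg (by positivity) _)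
      _ = ((4 / (Real.exp 1 * β)) ^ 2 * Real.exp A) ^ (L ^ 4) := by
          rw [pow_mul, mul_pow, ← Real.exp_nat_mul]
          congr 2
          push_cast
          ring
  -- (vi) the `L⁴`-th root
  have hroot : (wilsonExpectation r.ρ β (fun U : GaugeConfig 4 L G =>
      ∏ x : Site 4 L, ((r.N : ℝ) - (r.ρ (plaquetteHolonomy U x 0 1)).trace.re) ^ 2)) ^
        ((1 : ℝ) / (L : ℝ) ^ 4) ≤ (4 / (Real.exp 1 * β)) ^ 2 * Real.exp A := by
    have h0 : 0 ≤ wilsonExpectation r.ρ β (fun U : GaugeConfig 4 L G =>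
        ∏ x : Site 4 L, ((r.N : ℝ) - (r.ρ (plaquetteHolonomy U x 0 1)).trace.re) ^ 2) :=
      wilsonExpectation_nonneg r.ρ β fun U => Finset.prod_nonneg fun x _ => sq_nonneg _
    have hM0 : 0 ≤ (4 / (Real.exp 1 * β)) ^ 2 * Real.exp A := by positivity
    have hk0 : L ^ 4 ≠ 0 := pow_ne_zero 4 (NeZero.ne L)
    calc _ ≤ (((4 / (Real.exp 1 * β)) ^ 2 * Real.exp A) ^ (L ^ 4)) ^ ((1 : ℝ) / (L : ℝ) ^ 4) :=
          Real.rpow_le_rpow h0 hprod (by positivity)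
      _ = (4 / (Real.exp 1 * β)) ^ 2 * Real.exp A := by
          rw [one_div, ← Nat.cast_pow]
          exact Real.pow_rpow_inv_natCast hM0 hk0
  -- assembly: `Var ≤ |Var| ≤ ⟨P²⟩ ≤ ⟨∏ₓ P_x²⟩^{1/L⁴} ≤ (4/(eβ))² e^{A} = C₃ · (β²)⁻¹`
  have hβne : β ≠ 0 := hβ0.ne'
  calc _ ≤ (4 / (Real.exp 1 * β)) ^ 2 * Real.exp A :=
        (le_abs_self _).trans (hvar.trans (hf.trans hroot))
    _ = 16 * Real.exp A / Real.exp 1 ^ 2 * (β ^ 2)⁻¹ := by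
        field_simp
        ring

end Summit.QuantumFields.YangMills.Theorems.FemtoCurvatureTwoPointC

end
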